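import Mathlib
import Summits.ResolutionOfSingularities.ResolutionOfSingularities.Theorems.WeightedInvariantLocalWeightedDropTOT2CurveConflictDivTwo

/-!
# `LocalWeightedDrop`, NC count game — TOT2-LINE piece S-CRV (v1.3 (P3)): the CONVERSE of F1 — every graph branch at the origin of the `u₁`-chart
# comes from a tangent graph branch downstairs («no new `u₁`-graphs at the `u₁`-chart origin»)

[OURS · L1 W4.3 · chain w43, engine crux `LocalWeightedDrop` stmt-ResolutionOfSingularities-8899; piece (P3) = res-type-088; `--supports 8899 --as helper`,
counted 0; definition-free; nothing here is a statement of any manuscript; AI-written (gate-accepted = sorry-free with standard axioms, not refereed).]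

The budget law `hM_succ`/`hM_conf` at the `u₁`-chart origin needs BOTH directions: F1 (a tangent branch `u₁h₁` of `A` ↦ the branch `h₁` of
`blowOneT d A`, p532093) and its converse proved here:
* `le_order_shift_of_isPosT` — a re-centred position keeps `ord ≥ d − j` (weakly);
* `isPermissibleTwoT_of_blowOneT` — converse of `isPermissibleTwoT_blowOneT` for tuples with `ord ≥ d − j`;
* `blowOne_one_X_mul_of_noY` — `blowOne 1 (u₁·φ) = φ` for `u₂`-free `φ`;
* **`graph_of_blowOneT_origin`** — if `blowOneT d A` (A a position) carries a permissible graph branch with `u₂`-free datum `h₁`, then `A` carries one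
  with datum `u₁·h₁` (re-centring `u₁·ψ′(u₁,0)`); `hasGraphCurveT_of_blowOneT_origin` — predicate form.  So the `u₁`-graph data upstairs at the origin
  are EXACTLY the quotients `h/u₁` of the tangent data downstairs (with F1), and the budget's `u₁`-graph terms at that successor are accounted for.
-/

set_option linter.dupNamespace false -- mandated namespace of this single-conjunct summit

noncomputable section

namespace Summit.ResolutionOfSingularities.ResolutionOfSingularities.Theorems

namespace TOT2Curve

open MvPowerSeries PolyDescent MonicDescent WildMonic Literature.AlgebraicGeometry.Resolution

variable {k : Type} [Field k] {d : ℕ}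

/-- A re-centred position keeps `ord (shift d B g)_j ≥ d − j` when `g(0) = 0` (the term `C(d,j)·g^{d−j}` has order `≥ d − j`). -/
theorem le_order_shift_of_isPosT {B : Fin d → MvPowerSeries (Fin 2) k} (hB : IsPosT d B) {g : MvPowerSeries (Fin 2) k}
    (hg : constantCoeff g = 0) (j : Fin d) : ((d - (j : ℕ) : ℕ) : ℕ∞) ≤ (shift d B g j).order := by
  refine nat_le_order fun e he => ?_
  rw [shift_eq, map_add, map_sum]
  have hgpow : ∀ m : ℕ, (m : ℕ∞) ≤ (g ^ m).order := fun m => le_order_pow_of_constantCoeff_eq_zero m hg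
  have h1 : coeff e (((d.choose (j : ℕ) : ℕ) : MvPowerSeries (Fin 2) k) * g ^ (d - (j : ℕ))) = 0 := by
    rw [← map_natCast (C (σ := Fin 2) (R := k)), coeff_C_mul, coeff_of_lt_order (lt_of_lt_of_le (by exact_mod_cast he) (hgpow _)),
      mul_zero]
  rw [h1, zero_add]
  refine Finset.sum_eq_zero fun i _ => ?_
  by_cases hij : (j : ℕ) ≤ (i : ℕ)
  · rw [← map_natCast (C (σ := Fin 2) (R := k)), mul_assoc, coeff_C_mul, coeff_of_lt_order, mul_zero]
    refine lt_of_lt_of_le (b := (((d - (j : ℕ) : ℕ) : ℕ∞))) (by exact_mod_cast he) ?_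
    refine le_trans ?_ le_order_mul
    have hBi := (hB i).le
    calc (((d - (j : ℕ) : ℕ) : ℕ∞)) ≤ (((d - (i : ℕ) : ℕ) : ℕ∞)) + ((((i : ℕ) - (j : ℕ) : ℕ) : ℕ∞)) := by
          rw [← Nat.cast_add, Nat.cast_le]; omega
      _ ≤ (B i).order + (g ^ ((i : ℕ) - (j : ℕ))).order := add_le_add hBi (hgpow _)
  · rw [Nat.choose_eq_zero_of_lt (not_le.mp hij)]
    simp

/-- CONVERSE of `isPermissibleTwoT_blowOneT`: for a tuple with `ord C_j ≥ d − j` (no monomial is dropped by the chart), `V(y,u₂)` permissible upstairs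
forces it downstairs. -/
theorem isPermissibleTwoT_of_blowOneT {C : Fin d → MvPowerSeries (Fin 2) k} (hC : ∀ j : Fin d, ((d - (j : ℕ) : ℕ) : ℕ∞) ≤ (C j).order)
    (h : IsPermissibleTwoT d (blowOneT d C)) : IsPermissibleTwoT d C := by
  intro j e he
  have hsum : d - (j : ℕ) ≤ e 0 + e 1 := le_sum_of_le_order (hC j) e he
  have h1 := h j (Finsupp.single 0 (e 0 + e 1 - (d - (j : ℕ))) + Finsupp.single 1 (e 1)) (by
    show coeff _ (blowOne (d - (j : ℕ)) (C j)) ≠ 0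
    rw [coeff_blowOne]
    simp only [Finsupp.add_apply, Finsupp.single_apply, Fin.isValue, ↓reduceIte, Fin.one_eq_zero_iff, OfNat.ofNat_ne_one,
      zero_add, Fin.zero_eq_one_iff, add_zero]
    rw [if_pos (by omega)]
    have hidx : (Finsupp.single (0 : Fin 2) (e 0 + e 1 - (d - (j : ℕ)) + (d - (j : ℕ)) - e 1) + Finsupp.single 1 (e 1) : Fin 2 →₀ ℕ) = e :=
      Literature.RingTheory.TwoVariableSeries.finsupp_fin2_ext
        (by simp only [Finsupp.add_apply, Finsupp.single_apply]; simp; omega)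
        (by simp only [Finsupp.add_apply, Finsupp.single_apply]; simp)
    rw [hidx]
    exact he)
  simpa using h1

/-- Coefficients of `u₁ · φ`. -/
theorem coeff_X_zero_mul (φ : MvPowerSeries (Fin 2) k) (m : Fin 2 →₀ ℕ) :
    coeff m (X 0 * φ : MvPowerSeries (Fin 2) k) = if 1 ≤ m 0 then coeff (m - Finsupp.single 0 1) φ else 0 := by
  rw [X, coeff_monomial_mul]
  by_cases h : 1 ≤ m 0
  · rw [if_pos (Finsupp.le_def.mpr fun i => by fin_cases i <;> simp [h]), if_pos h, one_mul]
  · rw [if_neg (fun hle => h (by simpa using Finsupp.le_def.mp hle 0)), if_neg h]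

/-- `blowOne 1 (u₁ · φ) = φ` for a `u₂`-free `φ`. -/
theorem blowOne_one_X_mul_of_noY (φ : MvPowerSeries (Fin 2) k) (hφ : ∀ e : Fin 2 →₀ ℕ, e 1 ≠ 0 → coeff e φ = 0) :
    blowOne 1 (X 0 * φ) = φ := by
  ext e
  rw [coeff_blowOne]
  by_cases he1 : e 1 = 0
  · rw [if_pos (by omega), coeff_X_zero_mul, if_pos (by simp only [Finsupp.add_apply, Finsupp.single_apply]; simp; omega)]
    congr 2
    refine Literature.RingTheory.TwoVariableSeries.finsupp_fin2_ext ?_ ?_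
    · simp only [Finsupp.tsub_apply, Finsupp.add_apply, Finsupp.single_apply]; simp [he1]
    · simp only [Finsupp.tsub_apply, Finsupp.add_apply, Finsupp.single_apply]; simp [he1]
  · rw [hφ e he1]
    split_ifs with hle
    · rw [coeff_X_zero_mul]
      split_ifs with h1
      · exact hφ _ (by simp only [Finsupp.tsub_apply, Finsupp.add_apply, Finsupp.single_apply]; simpa using he1)
      · rfl
    · rfl

/-- **CONVERSE OF F1 — NO NEW `u₁`-GRAPHS AT THE `u₁`-CHART ORIGIN.**  If the `u₁`-chart `blowOneT d A` of a position `A` carries a permissible graph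
branch with `u₂`-free datum `h₁`, then `A` carries a permissible graph branch with the TANGENT datum `u₁·h₁` (re-centring `u₁·ψ′(u₁,0)`). -/
theorem graph_of_blowOneT_origin (A : Fin d → MvPowerSeries (Fin 2) k) (hA : IsPosT d A) (h₁ ψ' : MvPowerSeries (Fin 2) k)
    (hh₁ : ∀ e : Fin 2 →₀ ℕ, e 1 ≠ 0 → coeff e h₁ = 0) (hperm' : IsPermissibleTwoT d (shift d (shearT h₁ (blowOneT d A)) ψ')) :
    ∃ ψ : MvPowerSeries (Fin 2) k, constantCoeff ψ = 0 ∧ IsPermissibleTwoT d (shift d (shearT (X 0 * h₁) A) ψ) := by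
  -- the `u₂`-free presentation upstairs
  set φ' := subst (![X 0, 0] : Fin 2 → MvPowerSeries (Fin 2) k) ψ' with hφ'
  have hperm₀ : IsPermissibleTwoT d (shift d (shearT h₁ (blowOneT d A)) φ') := isPermissibleTwoT_shift_killTwo hperm'
  have hφ'_noY : ∀ e : Fin 2 →₀ ℕ, e 1 ≠ 0 → coeff e φ' = 0 := fun e he => by rw [hφ', coeff_subst_killTwo, if_neg he]
  -- push the shear and the re-centring downstairs
  set B := shearT (X 0 * h₁) A with hB
  have hBpos : IsPosT d B := isPosT_shearT _ hA
  have hcomm1 : shearT h₁ (blowOneT d A) = blowOneT d B :=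
    (blowOneT_shearT_X_mul h₁ hh₁ A (fun j => (hA j).le)).symm
  have hg0 : constantCoeff (X 0 * φ' : MvPowerSeries (Fin 2) k) = 0 := by rw [map_mul, constantCoeff_X, zero_mul]
  have hg1 : (1 : ℕ∞) ≤ (X 0 * φ' : MvPowerSeries (Fin 2) k).order := one_le_order_iff_constCoeff_eq_zero.mpr hg0
  have hcomm2 : blowOneT d (shift d B (X 0 * φ')) = shift d (blowOneT d B) φ' := by
    rw [blowOneT_shift B (X 0 * φ') (fun j => (hBpos j).le) hg1, blowOne_one_X_mul_of_noY φ' hφ'_noY]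
  rw [hcomm1, ← hcomm2] at hperm₀
  refine ⟨X 0 * φ', hg0, ?_⟩
  exact isPermissibleTwoT_of_blowOneT (fun j => le_order_shift_of_isPosT hBpos hg0 j) hperm₀

/-- Predicate form: a graph curve of `blowOneT d A` (A a position) comes from a graph curve of `A` tangent to `V(u₂)`. -/
theorem hasGraphCurveT_of_blowOneT_origin (A : Fin d → MvPowerSeries (Fin 2) k) (hA : IsPosT d A) (h : HasGraphCurveT d (blowOneT d A)) :
    ∃ h₁ ψ : MvPowerSeries (Fin 2) k, (∀ e : Fin 2 →₀ ℕ, e 1 ≠ 0 → coeff e h₁ = 0) ∧ constantCoeff ψ = 0 ∧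
      IsPermissibleTwoT d (shift d (shearT (X 0 * h₁) A) ψ) := by
  obtain ⟨h₁, ψ', hh₁, -, hperm'⟩ := h
  obtain ⟨ψ, hψ, hperm⟩ := graph_of_blowOneT_origin A hA h₁ ψ' hh₁ hperm'
  exact ⟨h₁, ψ, hh₁, hψ, hperm⟩

end TOT2Curve

end Summit.ResolutionOfSingularities.ResolutionOfSingularities.Theorems

end
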